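import Summits.ABC.IUTFork.LDHGenuinePerImageShellUniform
import Summits.ABC.IUTFork.LDHGenuinePerImageExplicit
import HarnessLib

/-!
# The fork at [IUTchIII] Corollary 3.12, L-DH level, READING (P): a POLYNOMIAL level — at a rational point the typed per-image
# Corollary holds at every prime `l` above the poles of `j` with `l^{ω+5/6} ≥ D_odd^{1/6}·rad_odd^{8/7}`
# (abc-iut cell, crux ThetaPartII = stmt-ABC-19678; refinement of row «C:PERIMAGE-EVENTUAL»)

Record-only PROOF file (D-0012) of the abc-iut cell (WAVE-3 discharge seat abc-iut-c312-d1, gen 10). TAKES NO SIDE on [IUTchIII]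
Cor. 3.12. Row «C:PERIMAGE-EVENTUAL» (`LDHGenuinePerImageEventual`, p498143; twin `LDHGenuinePerImageEventually`, C-cert-2 p497791) gave
a level `l₀` EXPONENTIAL in the height (`(2/9)·log q^∀ ≤ log l`, i.e. `D² ≤ l⁹`, from the `l`-adic different alone). This file reads
abc-iut-c312-d1 gen 9's UNIFORM SHELL TEST (`Cor22.cor312PerImageOf_ratPoint_shell_uniform`, p494091; the long-vector gain of the
wildly ramified log-shell, CONTAINER (Ind2)) with the universal choices `L₀ := l`, `P_sh := all odd poles` (every odd pole `p < l` is
admissible), `a_p := ⌊log_p l⌋` (so `p^{a_p} ≤ l ≤ a_p·l·k_p`), and the crude bounds `1 − 1/(l·k_p) ≥ 6/7`, `1 − 1/(l−1) ≥ 5/6`,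
`(a_p − p^{a_p}/(l·k_p))·log p ≥ (a_p − 1)·log p > log l − 2·log p`; it yields a level POLYNOMIAL in the data:

* **`Cor22.cor312PerImageOf_ratPoint_of_polyLevel`** — for `q ∈ ℚ ∖ {0,1}` with `j(q) = N/D` in lowest terms, `D = ∏_{p∈I} p^{e_p}`,
  `ω := #{p ∈ I : p ≠ 2}`, `R := Σ_{p∈I, p≠2} log p = log rad_odd(D)`, `Q := Σ_{p∈I, p≠2} e_p·log p = log D_odd`: every prime `l ≥ 7`
  EXCEEDING EVERY POLE (`p < l` for `p ∈ I`) with `Q/6 + (8/7)·R ≤ (ω + 5/6)·log l + ½·log 2 + log π` gives `T.Cor312PerImageOf` at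
  every genuine Θ-volume datum `T` of `(q, l)`; `…AtDatum…` / `cor312AtDatum_…` forms;
* **`Cor22.cor312PerImageAtDatum_ratPoint_of_pow_le`** — the INTEGER form: `l ≥ 7` prime above every pole and
  `D_odd^7 · rad_odd^48 ≤ l^{42·ω+35}` ⟹ `Cor312PerImageAtDatum (ratPoint q) l ∧ Cor312AtDatum (ratPoint q) l`.

So the exceptional levels of «C:PERIMAGE-EVENTUAL» all lie below `max(7, largest pole + 1, (D_odd^{1/6}·rad_odd^{8/7})^{1/(ω+5/6)})` —
a POWER of the denominator with exponent `≈ 1/(6ω)`: the more odd poles `j(q)` has, the LOWER the level from which the typed (container)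
per-image Corollary is a theorem (for the Frey point of `a + b = c`: `D_odd = (abc)_odd²`, `rad_odd = rad(abc)_odd`). HONEST SCOPE: a
statement about OUR typed objects (reading (P), container (Ind2) — whose faithfulness to print's factorwise `Ism` is the open question
of ref-b F-B28-1; over a region-stabilising sub-indeterminacy the gain used here is ZERO, `TensorPacketOrbitStable` /
`LDHGenuinePerImageZeroGain`); the tabulated rows of the cell give the sharper `L₀ ∈ {7, 11, 13}` per triple by certificate; nothing
here asserts the existence of Θ-data, Cor. 3.12 in general or in print, or abc. [cite: Mochizuki2012, IUTchIII Cor. 3.12 p. 173–174,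
proof Step (x) p. 181; IUTchIV Prop. 1.2 (i)(ii) p. 10, Thm. 1.10 Step (ii) p. 24, Step (v) p. 27–29] [cite: DupuyHilado2025, §4.9, §4.12]
[claim: Mochizuki2012, status: disputed] for every IUT quotation. PROOF-ONLY: no definitions, no new `Prop`.
-/

noncomputable section

open NumberField IsDedekindDomain Ideal Module

namespace Literature.IUT.LogVolume.Cor22

open Literature.NumberTheory.DiophantineGeometry.GenEll Summit.ABC.IUTFork Literature.IUT.HodgeTheaters
open Literature.NumberTheory.DiophantineGeometry.UniformABCConjecture

variable {q : ℚ} {N D : ℕ} {I : Finset ℕ} {e : ℕ → ℕ} {l : ℕ}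

/-- **RATIONAL POINTS, POLYNOMIAL LEVEL**: for `q ∈ ℚ ∖ {0,1}`, `j(q) = N/D` in lowest terms with `D = ∏_{p∈I} p^{e_p}`, and a prime
`l ≥ 7` ABOVE EVERY POLE (`p < l` for `p ∈ I`) such that
`(1/6)·Σ_{p∈I,p≠2} e_p·log p + (8/7)·Σ_{p∈I,p≠2} log p ≤ (#{p∈I : p≠2} + 5/6)·log l + ½·log 2 + log π`:
`T.Cor312PerImageOf` for EVERY genuine Θ-volume datum `T` of `(q, l)` — gen 9's uniform shell test with `L₀ = l`, `P_sh` = all odd poles,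
`a_p = ⌊log_p l⌋`. [cite: Mochizuki2012, IUTchIII Cor. 3.12 p. 173–174, proof Step (x) p. 181; IUTchIV Thm. 1.10 Step (ii) p. 24, Step (v) p. 27–29]
[claim: Mochizuki2012, status: disputed] -/
theorem cor312PerImageOf_ratPoint_of_polyLevel (hq0 : q ≠ 0) (hq1 : q ≠ 1)
    (hI : ∀ p ∈ I, p.Prime) (he : ∀ p ∈ I, e p ≠ 0) (hD : D = ∏ p ∈ I, p ^ e p)
    (hj : jInv q = (N : ℚ) / (D : ℚ)) (hN : N ≠ 0) (hcop : ∀ p ∈ I, ¬ p ∣ N)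
    (hl : l.Prime) (h7 : 7 ≤ l) (hlt : ∀ p ∈ I, p < l)
    (hlog : (1 / 6 : ℝ) * (∑ p ∈ I.filter (fun p => p ≠ 2), (e p : ℝ) * Real.log p)
        + (8 / 7 : ℝ) * (∑ p ∈ I.filter (fun p => p ≠ 2), Real.log p) ≤
      (((I.filter (fun p => p ≠ 2)).card : ℝ) + 5 / 6) * Real.log l + 2⁻¹ * Real.log 2 + Real.log Real.pi)
    (T : ThetaVolumeDatumAt (ratPoint q) l) : T.Cor312PerImageOf := by
  classical
  have hlI : l ∉ I := fun h => lt_irrefl l (hlt l h)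
  set S : Finset ℕ := I.filter (fun p => p ≠ 2) with hS
  set k : ℕ → ℕ := fun p => Nat.lcm (30 / Nat.gcd 30 (e p)) (if p = 3 then 2 else if p = 5 then 4 else 1) with hk
  have hkpos : ∀ p, 0 < k p := by
    intro p
    refine Nat.pos_of_ne_zero (Nat.lcm_ne_zero ?_ (by split_ifs <;> norm_num))
    exact (Nat.div_pos (Nat.le_of_dvd (by norm_num) (Nat.gcd_dvd_left 30 (e p))) (Nat.gcd_pos_of_pos_left _ (by norm_num))).ne'
  have hl0 : l ≠ 0 := by omega
  have hlR : (7 : ℝ) ≤ l := by exact_mod_cast h7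
  have hlpos : (0 : ℝ) < l := by linarith
  -- the universal shell data: all odd poles, `a_p = ⌊log_p l⌋`
  refine cor312PerImageOf_ratPoint_shell_uniform hq0 hq1 hI he hD hj hN hcop l h7 S (fun p => Nat.log p l)
    (Finset.filter_subset _ _) (fun p hp => (Finset.mem_filter.mp hp).2) (fun p hp => (hlt p (Finset.mem_filter.mp hp).1).le)
    (fun p hp => ?_) ?_ hl le_rfl hlI T
  · -- `p^{a_p} ≤ l ≤ a_p·(l·k_p)`
    have hpI := (Finset.mem_filter.mp hp).1
    have hpp := hI p hpI
    have ha : 0 < Nat.log p l := Nat.log_pos hpp.one_lt (hlt p hpI).le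
    have h1 : p ^ Nat.log p l ≤ l := Nat.pow_log_le_self p hl0
    have h2 : l ≤ Nat.log p l * (l * k p) := by
      calc l = 1 * (l * 1) := by ring
        _ ≤ Nat.log p l * (l * k p) := Nat.mul_le_mul ha (Nat.mul_le_mul_left l (hkpos p))
    have h12 : (p : ℝ) ^ Nat.log p l ≤ ((Nat.log p l * (l * k p) : ℕ) : ℝ) := by exact_mod_cast h1.trans h2
    push_cast at h12 ⊢
    exact h12
  · -- the real inequality (h) of the uniform test, from `hlog`
    -- (1) `W₀ ≥ (6/7)·R`
    have hW : (6 / 7 : ℝ) * (∑ p ∈ S, Real.log p) ≤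
        ∑ p ∈ S, (1 - ((l * k p : ℕ) : ℝ)⁻¹) * Real.log p := by
      rw [Finset.mul_sum]
      refine Finset.sum_le_sum fun p hp => ?_
      have hpp := hI p (Finset.mem_filter.mp hp).1
      have hlk : (7 : ℝ) ≤ ((l * k p : ℕ) : ℝ) := by
        have : 7 ≤ l * k p := le_trans h7 (Nat.le_mul_of_pos_right l (hkpos p))
        exact_mod_cast this
      have hinv : ((l * k p : ℕ) : ℝ)⁻¹ ≤ 7⁻¹ := inv_anti₀ (by norm_num) hlk
      exact mul_le_mul_of_nonneg_right (by linarith) (Real.log_nonneg (by exact_mod_cast hpp.one_lt.le))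
    -- (2) `Λ(l) ≥ (5/6)·log l`
    have hΛ : (5 / 6 : ℝ) * Real.log l ≤ (1 - ((l - 1 : ℕ) : ℝ)⁻¹) * Real.log l := by
      have h6 : (6 : ℝ) ≤ ((l - 1 : ℕ) : ℝ) := by
        have : 6 ≤ l - 1 := by omega
        exact_mod_cast this
      have hinv : ((l - 1 : ℕ) : ℝ)⁻¹ ≤ 6⁻¹ := inv_anti₀ (by norm_num) h6
      exact mul_le_mul_of_nonneg_right (by linarith) (Real.log_nonneg (by linarith))
    -- (3) shell: each odd pole gives `> log l − 2·log p`
    have hSh : ((S.card : ℝ)) * Real.log l - 2 * (∑ p ∈ S, Real.log p) ≤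
        ∑ p ∈ S, (((Nat.log p l : ℕ) : ℝ) - (p : ℝ) ^ Nat.log p l / ((l * k p : ℕ) : ℝ)) * Real.log p := by
      have hsum : ((S.card : ℝ)) * Real.log l - 2 * (∑ p ∈ S, Real.log p) =
          ∑ p ∈ S, (Real.log l - 2 * Real.log p) := by
        rw [Finset.sum_sub_distrib, Finset.sum_const, nsmul_eq_mul, Finset.mul_sum]
      rw [hsum]
      refine Finset.sum_le_sum fun p hp => ?_
      have hpI := (Finset.mem_filter.mp hp).1
      have hpp := hI p hpI
      have hpR : (1 : ℝ) < p := by exact_mod_cast hpp.one_lt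
      have hlogp : 0 < Real.log p := Real.log_pos hpR
      -- `p^{a_p} ≤ l·k_p`, so the subtracted ratio is `≤ 1`
      have h1 : p ^ Nat.log p l ≤ l := Nat.pow_log_le_self p hl0
      have hlk : l ≤ l * k p := Nat.le_mul_of_pos_right l (hkpos p)
      have hratio : (p : ℝ) ^ Nat.log p l / ((l * k p : ℕ) : ℝ) ≤ 1 := by
        rw [div_le_one (by exact_mod_cast Nat.mul_pos (by omega) (hkpos p))]
        exact_mod_cast h1.trans hlk
      -- `(a_p + 1)·log p > log l`
      have h2 : l < p ^ (Nat.log p l + 1) := Nat.lt_pow_succ_log_self hpp.one_lt l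
      have h2R : Real.log l < ((Nat.log p l : ℕ) + 1 : ℝ) * Real.log p := by
        have h' : (l : ℝ) < (p : ℝ) ^ (Nat.log p l + 1) := by exact_mod_cast h2
        have := Real.log_lt_log hlpos h'
        rwa [Real.log_pow, Nat.cast_add, Nat.cast_one] at this
      nlinarith
    -- (4) the indicator terms are nonnegative
    have hc3 : 0 ≤ (if 3 ∈ I then 0 else 2⁻¹ * Real.log 3 : ℝ) := by
      split_ifs
      · exact le_rfl
      · exact mul_nonneg (by norm_num) (Real.log_nonneg (by norm_num))
    have hc5 : 0 ≤ (if 5 ∈ I then 0 else (3 / 4 : ℝ) * Real.log 5 : ℝ) := by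
      split_ifs
      · exact le_rfl
      · exact mul_nonneg (by norm_num) (Real.log_nonneg (by norm_num))
    -- assemble
    have hcard : (((I.filter (fun p => p ≠ 2)).card : ℝ)) = S.card := by rw [hS]
    rw [hcard] at hlog
    linarith [hW, hΛ, hSh, hc3, hc5, hlog]

/-- **`Cor312PerImageAtDatum` / `Cor312AtDatum` at a polynomial level** (same hypotheses): both readings of the typed Corollary at
every genuine Θ-volume datum of `(q, l)`. [cite: Mochizuki2012, IUTchIII Cor. 3.12 p. 173–174] [claim: Mochizuki2012, status: disputed] -/
theorem cor312PerImageAtDatum_ratPoint_of_polyLevel (hq0 : q ≠ 0) (hq1 : q ≠ 1)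
    (hI : ∀ p ∈ I, p.Prime) (he : ∀ p ∈ I, e p ≠ 0) (hD : D = ∏ p ∈ I, p ^ e p)
    (hj : jInv q = (N : ℚ) / (D : ℚ)) (hN : N ≠ 0) (hcop : ∀ p ∈ I, ¬ p ∣ N)
    (hl : l.Prime) (h7 : 7 ≤ l) (hlt : ∀ p ∈ I, p < l)
    (hlog : (1 / 6 : ℝ) * (∑ p ∈ I.filter (fun p => p ≠ 2), (e p : ℝ) * Real.log p)
        + (8 / 7 : ℝ) * (∑ p ∈ I.filter (fun p => p ≠ 2), Real.log p) ≤
      (((I.filter (fun p => p ≠ 2)).card : ℝ) + 5 / 6) * Real.log l + 2⁻¹ * Real.log 2 + Real.log Real.pi) :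
    Cor312PerImageAtDatum (ratPoint q) l ∧ Cor312AtDatum (ratPoint q) l :=
  have h : Cor312PerImageAtDatum (ratPoint q) l :=
    fun T => cor312PerImageOf_ratPoint_of_polyLevel hq0 hq1 hI he hD hj hN hcop hl h7 hlt hlog T
  ⟨h, cor312AtDatum_of_perImage h⟩

/-- **THE INTEGER FORM**: `q ∈ ℚ ∖ {0,1}`, `j(q) = N/D` in lowest terms, `D = ∏_{p∈I} p^{e_p}`; `D_odd := ∏_{p∈I,p≠2} p^{e_p}`,
`rad_odd := ∏_{p∈I,p≠2} p`, `ω := #{p∈I : p≠2}`. Every prime `l ≥ 7` above every pole with **`D_odd^7 · rad_odd^48 ≤ l^{42·ω+35}`** gives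
the typed Corollary in both readings at every genuine Θ-volume datum of `(q, l)` (take logs: `7·Q + 48·R ≤ (42ω+35)·log l`, divide by
`42`, and `½·log 2 + log π > 0`). A POWER of the denominator with exponent `≈ 1/(6ω)`: the exceptional levels of «C:PERIMAGE-EVENTUAL»
lie below `max(7, largest pole + 1, (D_odd^{1/6}·rad_odd^{8/7})^{1/(ω+5/6)})`. [cite: Mochizuki2012, IUTchIII Cor. 3.12 p. 173–174;
IUTchIV Thm. 1.10 p. 23] [claim: Mochizuki2012, status: disputed] -/
theorem cor312PerImageAtDatum_ratPoint_of_pow_le (hq0 : q ≠ 0) (hq1 : q ≠ 1)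
    (hI : ∀ p ∈ I, p.Prime) (he : ∀ p ∈ I, e p ≠ 0) (hD : D = ∏ p ∈ I, p ^ e p)
    (hj : jInv q = (N : ℚ) / (D : ℚ)) (hN : N ≠ 0) (hcop : ∀ p ∈ I, ¬ p ∣ N)
    (hl : l.Prime) (h7 : 7 ≤ l) (hlt : ∀ p ∈ I, p < l)
    (hpow : (∏ p ∈ I.filter (fun p => p ≠ 2), p ^ e p) ^ 7 * (∏ p ∈ I.filter (fun p => p ≠ 2), p) ^ 48 ≤
      l ^ (42 * (I.filter (fun p => p ≠ 2)).card + 35)) :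
    Cor312PerImageAtDatum (ratPoint q) l ∧ Cor312AtDatum (ratPoint q) l := by
  classical
  refine cor312PerImageAtDatum_ratPoint_of_polyLevel hq0 hq1 hI he hD hj hN hcop hl h7 hlt ?_
  set S : Finset ℕ := I.filter (fun p => p ≠ 2) with hS
  have hSpos : ∀ p ∈ S, 0 < p := fun p hp => (hI p (Finset.mem_filter.mp hp).1).pos
  have hlR : (7 : ℝ) ≤ l := by exact_mod_cast h7
  -- logs of the two products
  have hQ : Real.log (((∏ p ∈ S, p ^ e p : ℕ)) : ℝ) = ∑ p ∈ S, (e p : ℝ) * Real.log p := by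
    rw [Nat.cast_prod, Real.log_prod]
    · exact Finset.sum_congr rfl fun p _ => by rw [Nat.cast_pow, Real.log_pow]
    · intro p hp; exact_mod_cast (pow_pos (hSpos p hp) _).ne'
  have hR : Real.log (((∏ p ∈ S, p : ℕ)) : ℝ) = ∑ p ∈ S, Real.log p := by
    rw [Nat.cast_prod, Real.log_prod]
    intro p hp; exact_mod_cast (hSpos p hp).ne'
  have hP1 : (0 : ℝ) < (((∏ p ∈ S, p ^ e p : ℕ)) : ℝ) := by
    exact_mod_cast Finset.prod_pos fun p hp => pow_pos (hSpos p hp) _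
  have hP2 : (0 : ℝ) < (((∏ p ∈ S, p : ℕ)) : ℝ) := by exact_mod_cast Finset.prod_pos hSpos
  -- take logs in `hpow`
  have h1 : (((∏ p ∈ S, p ^ e p : ℕ) : ℝ)) ^ 7 * (((∏ p ∈ S, p : ℕ) : ℝ)) ^ 48 ≤ (l : ℝ) ^ (42 * S.card + 35) := by
    exact_mod_cast hpow
  have h2 := Real.log_le_log (by positivity) h1
  rw [Real.log_mul (by positivity) (by positivity), Real.log_pow, Real.log_pow, Real.log_pow, hQ, hR] at h2
  push_cast at h2
  have hlog2 : 0 < Real.log 2 := Real.log_pos (by norm_num)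
  have hpi : 0 < Real.log Real.pi := Real.log_pos (by linarith [Real.pi_gt_three])
  have hcard : (((I.filter (fun p => p ≠ 2)).card : ℝ)) = S.card := by rw [hS]
  rw [hcard]
  nlinarith [h2, hlog2, hpi]

end Literature.IUT.LogVolume.Cor22

end
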